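import Summits.KontsevichZagierPeriods.KontsevichZagierPeriods.Theorems.HurwitzMicroSectorsNormalFormPrincipleWeightNLayer
import Summits.KontsevichZagierPeriods.KontsevichZagierPeriods.Theorems.HurwitzMicroSectorsNormalFormPrincipleLevelKTriangleSubDimOne
import Summits.KontsevichZagierPeriods.KontsevichZagierPeriods.Theorems.HurwitzMicroSectorsNormalFormPrincipleLevelKExistsReps
import Summits.KontsevichZagierPeriods.KontsevichZagierPeriods.Theorems.HurwitzMicroSectorsNormalFormPrincipleAlgMonomialsToPoints
import Summits.KontsevichZagierPeriods.KontsevichZagierPeriods.Theorems.HurwitzMicroSectorsNormalFormPrincipleLevelKDimOneAlgSlab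
import Summits.KontsevichZagierPeriods.KontsevichZagierPeriods.Theorems.HurwitzMicroSectorsNormalFormPrincipleDimOneAlgSlabs

/-!
# `NormalFormPrinciple` (stmt-KontsevichZagierPeriods-3869), line `SketchIdeator1` — leaf `stub_boxRigidity`:
# ALL WEIGHTS, ALL LEVELS, TOTALLY OFF RESONANCE, REAL-ALGEBRAIC COEFFICIENTS, I: reduction to `K`-rational slabs

The chains of `…WeightNLayer` (power substitution, sorting, merge, re-banding + Newton–Leibniz +
splitting, down to the level-`K` triangle and dimension one) use only moves whose coefficient may be
any real ALGEBRAIC number `c`; only the last identification changes: the end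
`[(0,1), (c/(a−b)) (u^b − u^a)/(1 − u^K)]` is, after cancelling `1 − u`, a `K`-rational slab
`[(0,1), P/Q]`, `P, Q ∈ K[X]` (`K = ℚ̄ ∩ ℝ`), `Q = 1 + u + ⋯ + u^{K−1}` pole-free on `[0,1]`
(`LevelK.levelK_dimOne_algSlab`) — a generator of seat c4's algebraic-slab layer. This file runs the
induction (`bandAlg_exists_mem_algSlabClosure`) and the box/level reductions with `c ∈ ℚ̄ ∩ ℝ`;
part II (`…WeightNAlgLayer`) is the kernel theorem. [cite: KontsevichZagier2001, §1.2]
No new definitions.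
-/

noncomputable section

open MeasureTheory Set
open scoped Polynomial
open Literature.NumberTheory.Transcendental Literature.NumberTheory.Transcendental.KZ
open Literature.ModelTheory.ExponentialFields (IsSemialgebraic)

namespace Summit.KontsevichZagierPeriods.HurwitzMicroSectors.NormalFormPrinciple.PiBox.WeightN

/-! ## The assembly (lead): algebraic coefficients — the chains end in `K`-rational slabs -/

open Summit.KontsevichZagierPeriods.HurwitzMicroSectors.NormalFormPrinciple.PiBox.LevelK
  (levelK_triangle_sub_dimOne levelK_exists_reps levelK_dimOne_algSlab)
open Summit.KontsevichZagierPeriods.HurwitzMicroSectors.NormalFormPrinciple.PiBox.AlgLevelOne (isAlgebraic_div_nat)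

/-- `c·N` is algebraic for algebraic `c` and a natural number `N`. [folklore] -/
theorem wna_isAlgebraic_mul_natCast {c : ℝ} (hc : IsAlgebraic ℚ c) (N : ℕ) :
    IsAlgebraic ℚ (c * (N : ℝ)) := by
  have h1 : IsIntegral ℚ c := isAlgebraic_iff_isIntegral.1 hc
  have h2 : IsIntegral ℚ ((N : ℚ) : ℝ) := isIntegral_algebraMap (R := ℚ) (A := ℝ) (x := (N : ℚ))
  have e : c * (N : ℝ) = c * ((N : ℚ) : ℝ) := by push_cast; ring
  rw [e]
  exact isAlgebraic_iff_isIntegral.2 (h1.mul h2)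

/-- **The induction with an algebraic coefficient**: the band `R_n(A; D)` (`A` strictly decreasing,
`c ∈ ℚ̄ ∩ ℝ`) is congruent modulo relations to an element of the subgroup generated by seat c4's
algebraic-slab generators. [cite: KontsevichZagier2001, §1.2] -/
theorem bandAlg_exists_mem_algSlabClosure (K : ℕ) (hK : 0 < K) :
    ∀ (n : ℕ) (A : Fin (n + 1) → ℕ) (D : ℕ), StrictAnti A → ∀ (c : ℝ), IsAlgebraic ℚ c →
    ∀ (R : IntegralRep (n + 2)),
    R.domain = KZlog.band {y : Fin (n + 1) → ℝ | ∀ i, y i ∈ Set.Ioo (0:ℝ) 1} (fun _ => (0:ℝ))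
      (fun y => ∏ i, y i) →
    EqOn R.integrand (fun z => c * (∏ i : Fin (n + 1), z (Fin.castSucc i) ^ (A i)) *
        z (Fin.last (n + 1)) ^ D / (1 - z (Fin.last (n + 1)) ^ K)) R.domain →
    ∃ x' ∈ AddSubgroup.closure
      ({y : FormalRep | ∃ (m : ℕ) (N : IntegralRep m), m ≤ 1 ∧ N.IsRational ∧ y = of N} ∪
       {y : FormalRep | ∃ (a b : ℝ) (P Q : (algebraicClosure ℚ ℝ)[X]) (N : IntegralRep 1),
          IsAlgebraic ℚ a ∧ IsAlgebraic ℚ b ∧ (∀ t ∈ Set.Icc a b, (Polynomial.aeval t Q : ℝ) ≠ 0) ∧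
          N.domain = {x | x 0 ∈ Set.Ioo a b} ∧
          EqOn N.integrand (fun x => (Polynomial.aeval (x 0) P : ℝ) / Polynomial.aeval (x 0) Q) N.domain ∧
          y = of N} ∪
       {y : FormalRep | ∃ (r : ℝ) (Z : IntegralRep 0), IsAlgebraic ℚ r ∧ Z.domain = univ ∧
          (Z.integrand = fun _ => r) ∧ y = of Z}),
      of R - x' ∈ relations := by
  intro n
  induction n with
  | zero =>
    intro A D _ c hc R hRd hRi
    obtain ⟨-, -, hexN₁⟩ := levelK_exists_reps K hK c hc
    obtain ⟨N₁, hN₁d, hN₁i⟩ := hexN₁ (A 0 + D + 1) D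
    have hRd' : R.domain = KZlog.band {y : Fin 1 → ℝ | 0 < y 0 ∧ y 0 < 1} (fun _ => (0:ℝ)) (fun y => y 0) := by
      rw [hRd]
      congr 1
      · ext y; simp [Fin.forall_fin_one]
      · funext y; simp
    have hRi' : EqOn R.integrand (fun z => c * (z 0 ^ (A 0 + D + 1 - D - 1) * z 1 ^ D) /
        (1 - z 1 ^ K)) R.domain := fun z hz => by
      rw [hRi hz]
      have e1 : A 0 + D + 1 - D - 1 = A 0 := by omega
      beta_reduce
      rw [e1, Fin.prod_univ_succ, Fin.prod_univ_zero, mul_one,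
        show (Fin.castSucc (0 : Fin (0 + 1)) : Fin (0 + 1 + 1)) = 0 from rfl,
        show (Fin.last (0 + 1) : Fin (0 + 1 + 1)) = 1 from rfl]
      ring
    have e := levelK_triangle_sub_dimOne K hK (A 0 + D + 1) D c hc (by omega) R N₁ hRd' hRi'
      hN₁d (hN₁i ▸ fun _ _ => rfl)
    obtain ⟨P, Q, hQ, hPQ⟩ := levelK_dimOne_algSlab K hK (A 0 + D + 1) D (by omega) c hc N₁ hN₁d
      (fun z _ => by rw [hN₁i])
    have hset : N₁.domain = {x : Fin 1 → ℝ | x 0 ∈ Set.Ioo (0:ℝ) 1} := by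
      rw [hN₁d]; ext x; simp [Fin.forall_fin_one]
    exact ⟨of N₁, AddSubgroup.subset_closure (Or.inl (Or.inr ⟨0, 1, P, Q, N₁, isAlgebraic_zero,
      isAlgebraic_one, hQ, hset, hPQ, rfl⟩)), e⟩
  | succ n ih =>
    intro A D hA c hc R hRd hRi
    have hlast : ∀ i : Fin (n + 1), A (Fin.last (n + 1)) + 1 ≤ A (Fin.castSucc i) := fun i =>
      hA (Fin.castSucc_lt_last i)
    obtain ⟨-, -, hexRn⟩ := exists_repsN K hK c hc
    obtain ⟨R', hR'd, hR'i⟩ := hexRn (n + 1) A D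
    have e0 := rebandN (n + 1) K hK A D c hc R R' hRd hRi hR'd (hR'i ▸ fun _ _ => rfl)
    set c' : ℝ := c / ((A (Fin.last (n + 1)) + 1 : ℕ) : ℝ) with hc'def
    have hc' : IsAlgebraic ℚ c' := isAlgebraic_div_nat hc _
    obtain ⟨-, hexR', -⟩ := exists_repsN K hK c' hc'
    obtain ⟨R₁, hR₁d, hR₁i⟩ := hexR' (n + 1) (fun i => A (Fin.castSucc i)) D (Nat.succ_pos n)
    obtain ⟨R₂, hR₂d, hR₂i⟩ := hexR' (n + 1) (fun i => A (Fin.castSucc i) - A (Fin.last (n + 1)) - 1)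
      (D + A (Fin.last (n + 1)) + 1) (Nat.succ_pos n)
    let T : IntegralRep (n + 2) :=
      ⟨R₁.domain, fun z => c' *
        ((∏ i : Fin (n + 1), z (Fin.castSucc i) ^ (A (Fin.castSucc i))) * z (Fin.last (n + 1)) ^ D -
         (∏ i : Fin (n + 1), z (Fin.castSucc i) ^ (A (Fin.castSucc i) - A (Fin.last (n + 1)) - 1)) *
           z (Fin.last (n + 1)) ^ (D + A (Fin.last (n + 1)) + 1)) / (1 - z (Fin.last (n + 1)) ^ K),
        R₁.isSemialgebraic_domain,
        (IsSemialgebraicFunOn.sub_holds R₁.isSemialgebraicFunOn_integrand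
          (hR₂d.trans hR₁d.symm ▸ R₂.isSemialgebraicFunOn_integrand)).congr fun z _ => by
            rw [hR₁i, hR₂i]; simp only [Pi.sub_apply]; ring,
        (R₁.integrableOn.sub ((hR₂d.trans hR₁d.symm) ▸ R₂.integrableOn)).congr_fun (fun z _ => by
            rw [hR₁i, hR₂i]; simp only [Pi.sub_apply]; ring) (IntegralRep.measurableSet_domain_holds R₁)⟩
    have hTd : T.domain = _ := hR₁d
    have e1' := stokesN (n + 1) K hK A D hlast c hc R' T hR'd (hR'i ▸ fun _ _ => rfl) hTd
      (fun z _ => by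
        show T.integrand z = _
        simp only [T, hc'def])
    have e1 : of R - of T ∈ relations := by
      have ee : of R - of T = (of R - of R') + (of R' - of T) := by abel
      rw [ee]; exact relations.add_mem e0 e1'
    have e2 : of R₁ - of T - of R₂ ∈ relations := by
      refine integrandAddRel_subset_relations ⟨n + 2, R₁, T, R₂, rfl, hR₂d.trans hR₁d.symm,
        fun z _ => ?_, rfl⟩
      show R₁.integrand z = T.integrand z + R₂.integrand z
      rw [hR₁i, hR₂i]
      simp only [T]
      ring
    have hA₁ : StrictAnti (fun i : Fin (n + 1) => A (Fin.castSucc i)) := fun i j hij =>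
      hA (Fin.castSucc_lt_castSucc_iff.2 hij)
    have hA₂ : StrictAnti (fun i : Fin (n + 1) => A (Fin.castSucc i) - A (Fin.last (n + 1)) - 1) := by
      intro i j hij
      have h1 := hA (Fin.castSucc_lt_castSucc_iff.2 hij)
      have h2 := hlast j
      simp only
      omega
    obtain ⟨x₁, hx₁, f₁⟩ := ih (fun i : Fin (n + 1) => A (Fin.castSucc i)) D hA₁ c' hc' R₁ hR₁d
      (fun z _ => by rw [hR₁i])
    obtain ⟨x₂, hx₂, f₂⟩ := ih (fun i : Fin (n + 1) => A (Fin.castSucc i) - A (Fin.last (n + 1)) - 1)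
      (D + A (Fin.last (n + 1)) + 1) hA₂ c' hc' R₂ hR₂d (fun z _ => by rw [hR₂i])
    refine ⟨x₁ - x₂, AddSubgroup.sub_mem _ hx₁ hx₂, ?_⟩
    have e : of R - (x₁ - x₂) = (of R - of T) - (of R₁ - of T - of R₂) + (of R₁ - x₁) - (of R₂ - x₂) := by
      abel
    rw [e]
    exact relations.sub_mem (relations.add_mem (relations.sub_mem e1 e2) f₁) f₂

/-- **From the box to the band, algebraic coefficient** (`w = n + 2 ≥ 2`): sort, merge, induction.
[cite: KontsevichZagier2001, §1.2] -/
theorem boxAlg_exists_mem_algSlabClosure (K : ℕ) (hK : 0 < K) (n : ℕ) (e : Fin (n + 2) → ℕ)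
    (he : Function.Injective e) (c : ℝ) (hc : IsAlgebraic ℚ c) (N : IntegralRep (n + 2))
    (hNd : N.domain = {x | ∀ i, x i ∈ Set.Ioo (0:ℝ) 1})
    (hNi : EqOn N.integrand (fun x => c * (∏ l, x l ^ (e l)) / (1 - ∏ l, x l ^ K)) N.domain) :
    ∃ x' ∈ AddSubgroup.closure
      ({y : FormalRep | ∃ (m : ℕ) (N : IntegralRep m), m ≤ 1 ∧ N.IsRational ∧ y = of N} ∪
       {y : FormalRep | ∃ (a b : ℝ) (P Q : (algebraicClosure ℚ ℝ)[X]) (N : IntegralRep 1),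
          IsAlgebraic ℚ a ∧ IsAlgebraic ℚ b ∧ (∀ t ∈ Set.Icc a b, (Polynomial.aeval t Q : ℝ) ≠ 0) ∧
          N.domain = {x | x 0 ∈ Set.Ioo a b} ∧
          EqOn N.integrand (fun x => (Polynomial.aeval (x 0) P : ℝ) / Polynomial.aeval (x 0) Q) N.domain ∧
          y = of N} ∪
       {y : FormalRep | ∃ (r : ℝ) (Z : IntegralRep 0), IsAlgebraic ℚ r ∧ Z.domain = univ ∧
          (Z.integrand = fun _ => r) ∧ y = of Z}),
      of N - x' ∈ relations := by
  obtain ⟨σ, hσ⟩ := exists_perm_strictAnti e he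
  obtain ⟨hexN, hexR, -⟩ := exists_repsN K hK c hc
  obtain ⟨N', hN'd, hN'i⟩ := hexN (n + 2) (e ∘ σ) (by omega)
  have e0 := permN (n + 2) K hK e σ c hc N N' hNd hNi hN'd (hN'i ▸ fun _ _ => rfl)
  set A : Fin (n + 1) → ℕ := fun i => (e ∘ σ) (Fin.castSucc i) - (e ∘ σ) (Fin.last (n + 1)) - 1 with hAdef
  have hlast : ∀ i : Fin (n + 1), (e ∘ σ) (Fin.last (n + 1)) < (e ∘ σ) (Fin.castSucc i) := fun i =>
    hσ (Fin.castSucc_lt_last i)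
  obtain ⟨R, hRd, hRi⟩ := hexR (n + 1) A ((e ∘ σ) (Fin.last (n + 1))) (Nat.succ_pos n)
  have e1 := mergeN (n + 1) K hK (e ∘ σ) hlast c hc N' R hN'd (hN'i ▸ fun _ _ => rfl) hRd
    (fun z _ => by rw [hRi])
  have hA : StrictAnti A := by
    intro i j hij
    have h1 := hσ (Fin.castSucc_lt_castSucc_iff.2 hij)
    have h2 := hlast j
    simp only [hAdef, Function.comp] at h1 h2 ⊢
    omega
  obtain ⟨x', hx', e2⟩ := bandAlg_exists_mem_algSlabClosure K hK n A _ hA c hc R hRd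
    (fun z _ => by rw [hRi])
  refine ⟨x', hx', ?_⟩
  have ee : of N - x' = (of N - of N') + (of N' - of R) + (of R - x') := by abel
  rw [ee]
  exact relations.add_mem (relations.add_mem e0 e1) e2

/-- **General levels, algebraic coefficient**: pairwise distinct resonance parameters, one power
substitution to the uniform level `K = Π kⱼ`. [cite: KontsevichZagier2001, §1.2 rule (2)] -/
theorem offresNAlg_exists_mem_algSlabClosure (n : ℕ) (k e : Fin (n + 2) → ℕ) (hk : ∀ i, 0 < k i)
    (hres : ∀ i j, i ≠ j → (e i + 1) * k j ≠ (e j + 1) * k i) (c : ℝ) (hc : IsAlgebraic ℚ c)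
    (N : IntegralRep (n + 2)) (hNd : N.domain = {x | ∀ i, x i ∈ Set.Ioo (0:ℝ) 1})
    (hNi : EqOn N.integrand (fun x => c * (∏ l, x l ^ (e l)) / (1 - ∏ l, x l ^ (k l))) N.domain) :
    ∃ x' ∈ AddSubgroup.closure
      ({y : FormalRep | ∃ (m : ℕ) (N : IntegralRep m), m ≤ 1 ∧ N.IsRational ∧ y = of N} ∪
       {y : FormalRep | ∃ (a b : ℝ) (P Q : (algebraicClosure ℚ ℝ)[X]) (N : IntegralRep 1),
          IsAlgebraic ℚ a ∧ IsAlgebraic ℚ b ∧ (∀ t ∈ Set.Icc a b, (Polynomial.aeval t Q : ℝ) ≠ 0) ∧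
          N.domain = {x | x 0 ∈ Set.Ioo a b} ∧
          EqOn N.integrand (fun x => (Polynomial.aeval (x 0) P : ℝ) / Polynomial.aeval (x 0) Q) N.domain ∧
          y = of N} ∪
       {y : FormalRep | ∃ (r : ℝ) (Z : IntegralRep 0), IsAlgebraic ℚ r ∧ Z.domain = univ ∧
          (Z.integrand = fun _ => r) ∧ y = of Z}),
      of N - x' ∈ relations := by
  classical
  set K : ℕ := ∏ j, k j with hKdef
  set m : Fin (n + 2) → ℕ := fun i => ∏ j ∈ Finset.univ.erase i, k j with hmdef
  have hmK : ∀ i, k i * m i = K := fun i => by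
    simp only [hmdef, hKdef]
    exact Finset.mul_prod_erase _ _ (Finset.mem_univ i)
  have hm : ∀ i, 0 < m i := fun i => Finset.prod_pos fun j _ => hk j
  have hK : 0 < K := Finset.prod_pos fun j _ => hk j
  set c' : ℝ := c * ((∏ i, m i : ℕ) : ℝ) with hc'def
  have hc' : IsAlgebraic ℚ c' := wna_isAlgebraic_mul_natCast hc _
  obtain ⟨hexN, -, -⟩ := exists_repsN K hK c' hc'
  obtain ⟨N', hN'd, hN'i⟩ := hexN (n + 2) (fun i => (e i + 1) * m i - 1) (by omega)
  have e0 := power_substitutionN (n + 2) m k e hm hk c hc N N' hNd hNi hN'd (fun x _ => by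
    rw [hN'i, hc'def]
    have hprod : (∏ i, x i ^ (k i * m i)) = ∏ i, x i ^ K := Finset.prod_congr rfl fun i _ => by rw [hmK]
    beta_reduce
    rw [hprod])
  have hinj : Function.Injective (fun i => (e i + 1) * m i - 1) := by
    intro i j hij
    by_contra hne
    apply hres i j hne
    have hi : 0 < (e i + 1) * m i := Nat.mul_pos (Nat.succ_pos _) (hm i)
    have hj : 0 < (e j + 1) * m j := Nat.mul_pos (Nat.succ_pos _) (hm j)
    have h1 : (e i + 1) * m i = (e j + 1) * m j := by
      simp only at hij
      omega
    have h2 : (e i + 1) * k j * K = (e j + 1) * k i * K := by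
      calc (e i + 1) * k j * K = (e i + 1) * k j * (k i * m i) := by rw [hmK]
        _ = ((e i + 1) * m i) * (k i * k j) := by ring
        _ = ((e j + 1) * m j) * (k i * k j) := by rw [h1]
        _ = (e j + 1) * k i * (k j * m j) := by ring
        _ = (e j + 1) * k i * K := by rw [hmK]
    exact Nat.eq_of_mul_eq_mul_right hK h2
  obtain ⟨x', hx', e1⟩ := boxAlg_exists_mem_algSlabClosure K hK n _ hinj c' hc' N' hN'd
    (fun x _ => by rw [hN'i])
  refine ⟨x', hx', ?_⟩
  have ee : of N - x' = (of N - of N') + (of N' - x') := by abel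
  rw [ee]
  exact relations.add_mem e0 e1

end Summit.KontsevichZagierPeriods.HurwitzMicroSectors.NormalFormPrinciple.PiBox.WeightN
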